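import Summits.Parity.GeneralizedHardyLittlewood.Theorems.BeyondDiagonalBeatsQuarter.CornerWeight
import Literature.NumberTheory.LFunctions.KMVCutoffW
import HarnessLib

/-!
# Route `PrimeLevelFamEdge`, crux K_B (stmt-Parity-20343), line `diagonal_kernel_split`:
# the bridge `𝒲 = Σ_{l ≥ 1} W(l² ·)/l` between the corner weight `Corner.scriptW` (helper H1,
# `CornerWeight.lean`) and KMV's cut-off `KMV2000.cutoffW` (H-AFE, `KMVCentralValueSquaredAFE.lean`)

`Corner.scriptW y = ∫_0^∞ dv/(e^{v + y/v} − 1)` is the real form of the TRUE Petersson-diagonal weight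
`𝒲(y) = Σ_{l ≥ 1} W(l² y)/l`, `W(y) = KMV2000.cutoffW y = ∫_0^∞ e^{−u − y/u} du`
([KowalskiMichelVanderKam2000] (21)–(23) p. 12–13, Prop. 5.1): substitute `u = l v` in `W(l² y)` and sum
the geometric series `Σ_{l ≥ 1} e^{−l x} = 1/(eˣ − 1)`, `x = v + y/v > 0`; the interchange is Tonelli
(all terms are non-negative; `Σ_l W(l² y)/l ≤ Σ_l 2e^{−l√y} < ∞` by `cutoffW_le_two_mul_exp_neg_sqrt`).
Candidate proof by refuter ls-ref-1 g16 (`BridgeScriptW.lean` sha16 890fe027745de297, evidence on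
stmt-Parity-20343, D1 of the W3 second read of H1 p624812), landed unchanged by the line lead ls-Bfam-prover-1 g9.
This file PROVES exactly that identity (`scriptW_eq_tsum_cutoffW`), with the index shifted to `l : ℕ`
(`l + 1 ≥ 1`). It is the one interface lemma (D1 of the W3 second read of H1 p624812) where the landed
true-diagonal kernel `Corner.trueDiagKernel = hKernel scriptW` meets the `cutoffW`-weighted summand
`KMV2000.afeSqTerm` of the exact formula `completedL_half_sq_eq`. Pure real analysis over Mathlib; nothing
about L-functions is asserted. «The programme SEARCHES and TYPES; no claim about Landau–Siegel zeros,
Theorems 1–2 of arXiv:2211.02515 or a repaired Margin232 until a kernel theorem says so.»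
-/

noncomputable section

open Real Set MeasureTheory Filter Topology
open Literature.NumberTheory.LFunctions

namespace Summit.Parity.GeneralizedHardyLittlewood.Theorems.BeyondDiagonalBeatsQuarter.Corner

/-- The `l`-th layer `v ↦ e^{−(l+1)(v + y/v)}` of the Bose kernel `1/(e^{v+y/v} − 1)` is integrable on
`(0, ∞)` for `y ≥ 0` (dominated by `e^{−v}`). [folklore] -/
theorem integrableOn_exp_layer {y : ℝ} (hy : 0 ≤ y) (l : ℕ) :
    IntegrableOn (fun v : ℝ ↦ Real.exp (-((l : ℝ) + 1) * (v + y / v))) (Ioi 0) := by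
  have hmeas : Measurable (fun v : ℝ ↦ Real.exp (-((l : ℝ) + 1) * (v + y / v))) := by fun_prop
  refine Integrable.mono' KMV2000.integrableOn_exp_neg_Ioi hmeas.aestronglyMeasurable ?_
  rw [ae_restrict_iff' measurableSet_Ioi]
  refine ae_of_all _ fun v (hv : 0 < v) ↦ ?_
  rw [Real.norm_of_nonneg (Real.exp_pos _).le]
  refine Real.exp_le_exp.2 ?_
  have hl : (0 : ℝ) ≤ l := l.cast_nonneg
  have hyv : 0 ≤ y / v := div_nonneg hy hv.le
  nlinarith [mul_nonneg hl hv.le, mul_nonneg hl hyv]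

/-- **`∫_0^∞ e^{−(l+1)(v + y/v)} dv = W((l+1)² y)/(l+1)`** (substitute `u = (l+1) v` in
`W(Y) = ∫_0^∞ e^{−u − Y/u} du`). [cite: KowalskiMichelVanderKam2000, (21)–(23) p. 12 and Prop. 5.1 — derivation] -/
theorem integral_exp_layer (y : ℝ) (l : ℕ) :
    ∫ v in Ioi (0 : ℝ), Real.exp (-((l : ℝ) + 1) * (v + y / v))
      = KMV2000.cutoffW ((((l : ℝ) + 1) ^ 2) * y) / ((l : ℝ) + 1) := by
  set L : ℝ := (l : ℝ) + 1 with hL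
  have hL0 : 0 < L := by positivity
  have hL0' : L ≠ 0 := hL0.ne'
  have hsub := MeasureTheory.integral_comp_mul_left_Ioi
    (fun u : ℝ ↦ Real.exp (-u - (L ^ 2 * y) / u)) 0 hL0
  simp only [mul_zero, smul_eq_mul] at hsub
  have hcongr : ∫ v in Ioi (0 : ℝ), Real.exp (-L * (v + y / v))
      = ∫ v in Ioi (0 : ℝ), Real.exp (-(L * v) - (L ^ 2 * y) / (L * v)) := by
    refine setIntegral_congr_fun measurableSet_Ioi fun v hv ↦ ?_
    have hv0 : (v : ℝ) ≠ 0 := ne_of_gt hv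
    congr 1
    field_simp
    ring
  rw [hcongr, hsub, KMV2000.cutoffW, div_eq_inv_mul]

/-- **Geometric series of the Bose kernel**: for `v > 0`, `y ≥ 0`,
`Σ_{l ≥ 0} e^{−(l+1)(v + y/v)} = 1/(e^{v + y/v} − 1)`. [folklore] -/
theorem hasSum_exp_layer {y v : ℝ} (hy : 0 ≤ y) (hv : 0 < v) :
    HasSum (fun l : ℕ ↦ Real.exp (-((l : ℝ) + 1) * (v + y / v))) (Real.exp (v + y / v) - 1)⁻¹ := by
  have hx0 : 0 < v + y / v := phi_pos hy hv
  have hr0 : 0 ≤ Real.exp (-(v + y / v)) := (Real.exp_pos _).le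
  have hr1 : Real.exp (-(v + y / v)) < 1 := Real.exp_lt_one_iff.2 (by linarith)
  have hfun : (fun l : ℕ ↦ Real.exp (-((l : ℝ) + 1) * (v + y / v)))
      = fun l : ℕ ↦ Real.exp (-(v + y / v)) * Real.exp (-(v + y / v)) ^ l := by
    funext l
    rw [← pow_succ', ← Real.exp_nat_mul]
    congr 1
    push_cast
    ring
  have hval : (Real.exp (v + y / v) - 1)⁻¹
      = Real.exp (-(v + y / v)) * (1 - Real.exp (-(v + y / v)))⁻¹ := by
    have he : Real.exp (v + y / v) ≠ 0 := (Real.exp_pos _).ne'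
    rw [Real.exp_neg, ← mul_inv, mul_sub, mul_one, mul_inv_cancel₀ he]
  rw [hfun, hval]
  exact (hasSum_geometric_of_lt_one hr0 hr1).mul_left (Real.exp (-(v + y / v)))

/-- The layers are summable after integration: `Σ_l W((l+1)² y)/(l+1) < ∞` for `y > 0`
(`W(Y) ≤ 2e^{−√Y}`). [folklore] -/
theorem summable_cutoffW_sq_div {y : ℝ} (hy : 0 < y) :
    Summable (fun l : ℕ ↦ KMV2000.cutoffW ((((l : ℝ) + 1) ^ 2) * y) / ((l : ℝ) + 1)) := by
  set ρ : ℝ := Real.exp (-Real.sqrt y) with hρ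
  have hρ0 : 0 ≤ ρ := (Real.exp_pos _).le
  have hρ1 : ρ < 1 := Real.exp_lt_one_iff.2 (by linarith [Real.sqrt_pos.2 hy])
  have hgeom : Summable (fun l : ℕ ↦ 2 * ρ * ρ ^ l) :=
    (summable_geometric_of_lt_one hρ0 hρ1).mul_left (2 * ρ)
  refine Summable.of_nonneg_of_le (fun l ↦ ?_) (fun l ↦ ?_) hgeom
  · exact div_nonneg (KMV2000.cutoffW_nonneg _) (by positivity)
  · have hLpos : (0 : ℝ) < (l : ℝ) + 1 := by positivity
    have hL1 : (1 : ℝ) ≤ (l : ℝ) + 1 := by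
      have : (0 : ℝ) ≤ l := l.cast_nonneg
      linarith
    calc KMV2000.cutoffW ((((l : ℝ) + 1) ^ 2) * y) / ((l : ℝ) + 1)
        ≤ KMV2000.cutoffW ((((l : ℝ) + 1) ^ 2) * y) := div_le_self (KMV2000.cutoffW_nonneg _) hL1
      _ ≤ 2 * Real.exp (-Real.sqrt ((((l : ℝ) + 1) ^ 2) * y)) :=
          KMV2000.cutoffW_le_two_mul_exp_neg_sqrt (by positivity)
      _ = 2 * ρ ^ (l + 1) := by
          rw [Real.sqrt_mul' _ hy.le, Real.sqrt_sq hLpos.le, hρ, ← Real.exp_nat_mul]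
          congr 2
          push_cast
          ring
      _ = 2 * ρ * ρ ^ l := by ring

/-- **`𝒲(y) = Σ_{l ≥ 1} W(l² y)/l`** (`y > 0`): the corner weight `Corner.scriptW` of helper H1 is the
TRUE Petersson-diagonal weight built from KMV's cut-off `W = KMV2000.cutoffW` of the exact formula (21):
`∫_0^∞ dv/(e^{v+y/v} − 1) = Σ_{l ≥ 0} cutoffW((l+1)² y)/(l+1)` — expand `1/(eˣ − 1) = Σ_{l≥1} e^{−lx}`,
integrate termwise (Tonelli), substitute `u = l v`. [cite: KowalskiMichelVanderKam2000, (21)–(23) p. 12–13 and Prop. 5.1 — derivation (real form of the diagonal weight)] -/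
theorem scriptW_eq_tsum_cutoffW {y : ℝ} (hy : 0 < y) :
    scriptW y = ∑' l : ℕ, KMV2000.cutoffW ((((l : ℝ) + 1) ^ 2) * y) / ((l : ℝ) + 1) := by
  have hF_int : ∀ l : ℕ, Integrable (fun v : ℝ ↦ Real.exp (-((l : ℝ) + 1) * (v + y / v)))
      (volume.restrict (Ioi 0)) := fun l ↦ integrableOn_exp_layer hy.le l
  have hF_sum : Summable
      (fun l : ℕ ↦ ∫ v in Ioi (0 : ℝ), ‖Real.exp (-((l : ℝ) + 1) * (v + y / v))‖) := by
    have heq : (fun l : ℕ ↦ ∫ v in Ioi (0 : ℝ), ‖Real.exp (-((l : ℝ) + 1) * (v + y / v))‖)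
        = fun l : ℕ ↦ KMV2000.cutoffW ((((l : ℝ) + 1) ^ 2) * y) / ((l : ℝ) + 1) := by
      funext l
      rw [← integral_exp_layer y l]
      refine integral_congr_ae (ae_of_all _ fun v ↦ ?_)
      exact Real.norm_of_nonneg (Real.exp_pos _).le
    rw [heq]
    exact summable_cutoffW_sq_div hy
  calc scriptW y = ∫ v in Ioi (0 : ℝ), ∑' l : ℕ, Real.exp (-((l : ℝ) + 1) * (v + y / v)) := by
        unfold scriptW
        refine setIntegral_congr_fun measurableSet_Ioi fun v hv ↦ ?_
        exact ((hasSum_exp_layer hy.le hv).tsum_eq).symm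
    _ = ∑' l : ℕ, ∫ v in Ioi (0 : ℝ), Real.exp (-((l : ℝ) + 1) * (v + y / v)) :=
        (integral_tsum_of_summable_integral_norm hF_int hF_sum).symm
    _ = ∑' l : ℕ, KMV2000.cutoffW ((((l : ℝ) + 1) ^ 2) * y) / ((l : ℝ) + 1) :=
        tsum_congr fun l ↦ integral_exp_layer y l

/-- The same bridge indexed by `l : ℕ` without the shift (`l ≥ 1`; the `l = 0` summand is Mathlib's
junk `W(0)/0 = 0`): `𝒲(y) = Σ'_{l : ℕ} W(l² y)/l`.
[cite: KowalskiMichelVanderKam2000, (21)–(23) p. 12–13 and Prop. 5.1 — derivation] -/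
theorem scriptW_eq_tsum_cutoffW' {y : ℝ} (hy : 0 < y) :
    scriptW y = ∑' l : ℕ, KMV2000.cutoffW (((l : ℝ) ^ 2) * y) / (l : ℝ) := by
  set f : ℕ → ℝ := fun l ↦ KMV2000.cutoffW (((l : ℝ) ^ 2) * y) / (l : ℝ) with hf
  have hshift : (fun l : ℕ ↦ f (l + 1))
      = fun l : ℕ ↦ KMV2000.cutoffW ((((l : ℝ) + 1) ^ 2) * y) / ((l : ℝ) + 1) := by
    funext l
    simp only [hf, Nat.cast_add, Nat.cast_one]
  have hs : Summable f := by
    rw [← summable_nat_add_iff 1, hshift]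
    exact summable_cutoffW_sq_div hy
  rw [hs.tsum_eq_zero_add, hshift, ← scriptW_eq_tsum_cutoffW hy]
  simp [hf]

end Summit.Parity.GeneralizedHardyLittlewood.Theorems.BeyondDiagonalBeatsQuarter.Corner

end
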